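import Literature.MathematicalPhysics.QuantumFieldTheory.Balaban1983to89.B12Decay510FromB11
import Literature.MathematicalPhysics.QuantumFieldTheory.Balaban1983to89.B11Ineq190Actual

/-!
# `Balaban1983to89.B12Decay510SectG` — T. Bałaban, *Renormalization group approach to lattice gauge field theories. I*,
# Commun. Math. Phys. **109** (1987) 249–301 [Balaban1987RG1] = [I], §5 p. 293: the strip decay **(5.10)**
# `|Π_{μν}(x − y)| ≤ O(1)E₀exp(−δ₁|x − y|)` — the cell's derivation `B12Decay510FromB11.decay510_window_190` (b2b-balaban b03 g4:
# every leaf of `B12Decay510` discharged except the (190) record `h190` and the dictionary letters) with `h190` SUPPLIED BY NAME from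
# [15] = [Balaban1985Variational] Sect. G for the ACTUAL Fréchet derivative at `B = 0` of the (179) chart (r08 `B11Ineq190Actual.ineq190_sectG`)

statement-level skeleton of published theorems with citation tags; proofs where landed; nothing here is a claim
about the Yang–Mills mass gap

CITATION HEADER (lean-in-tree rule 2026-08-18).  T. Bałaban, *Renormalization group approach to lattice gauge field theories.
I. Generation of effective actions in a small field approximation and a coupling constant renormalization in four dimensions*,
Commun. Math. Phys. **109**, 249–301 (1987), doi:10.1007/BF01215223, bib `Balaban1987RG1` (cell paper B12 = "[I]"; PDF held
`paper:balaban1987-cmp109-rg-i-small-field`, p. 293 = PDF 45, p. 282 = PDF 34).  "[15]" = T. Bałaban, *The variational problem and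
background fields in renormalization group method for lattice gauge theories*, Commun. Math. Phys. **102**, 277–309 (1985), bib
`Balaban1985Variational` (cell paper B11; Prop. 9 p. 309, (190) p. 308, (179)–(180) p. 306).  "[3]" of [15] = T. Bałaban,
*Propagators and renormalization transformations for lattice gauge theories. II*, Commun. Math. Phys. **96** (1984) 223–250, bib
`Balaban1984PropagatorsII` (Lemma 2.1 (2.61) p. 234).  Mega-formalization `lit-balaban`, HOME `run/shared/lean/pub/lit-balaban/`,
unit `lit-balaban-r20` gen 13 (B12 fold owner).

WHAT IS REPRODUCED.  SKELETON row **B12.Eq5.42** (member (5.10); decl of record `B12Sec2to5.Decay510`; display owner r09) and the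
p. 282 first-order sentence (row B12.Eq4.5).  THE PRINT, p. 293 [PDF 45], verbatim: *"|Π_{μν}(x − y)| ≤ O(1)E₀ exp(−δ₁|x − y|), (5.10)
… e.g., δ₁ = ½ min{δ₀, κM⁻¹}"*; p. 282 [PDF 34]: *"The norm in (4.4) of the expression ⟨(δ^{n(p)}/δB^{n(p)})𝐇_j(□₀, 0),
⊗_{i∈N(p)}B_i⟩ can be estimated by B₃Π_{i∈N(p)}|B_i|, and if one of the functions B_i is localized outside the domain X, then we
have the additional exponential factor exp(−δ₀dist^{(ξ)}(X, supp B_i))."*; [15] Prop. 9 p. 309: *"… its functional derivative (182)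
satisfies the inequalities (190)."*

THE CHAIN, BY NAME (nothing restated, nothing modified).  The pub-balaban lineage `B12Decay510` → `B12Decay510Window` →
`B12Decay510FromB11` derives (5.10) in its typed form `B12Sec2to5.Decay510 P C δ₁` (the kernel `P` of the infinite-volume limit of the
strip sums of (5.1)) on exhausting windows of ℤᵈ from: the analyticity (4.4) and the sup (1.18) of `𝐀 ↦ 𝐄^{(j)}(X, exp iξ𝐀)` per window,
the representation of the two-point kernel as a mixed second derivative, the geometric leaves (discharged on windows), AND — for the
`n(p) = 1` block of p. 282 — the (190) record `h190 : ∀ n i, Ineq190 (bB n) (bout n i) (dH n) C δ₀` for an ABSTRACT ℝ-linear `dH n`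
(= (δ𝐇_j(□₀,0)/δB) on the n-th window) with ONE constant `C` uniform in `n`, the row sum (2.61), and the three dictionary letters
(`NormDominated`, the size and the localisation of the unit source fields).  r08 g10's `B11Ineq190Actual.ineq190_sectG` PRODUCES
(190) for the ACTUAL derivative `fderiv ℂ (chartH179 𝒢 W D2 H₀ (· − H(D ·)) ε₄) 0` of the [15] (179) chart at the base point from the
located leaves of [15] Sect. G, with the EXPLICIT constant `const190 κ_B κ_N κ₃ B_G θ_W c_Δ A₀ A_H θ_𝔇 c`.  THIS FILE feeds the
latter into the former on every window, so that in the cell's derivation of (5.10) the (190) record is no longer a hypothesis: on the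
n-th window `dH n` IS `(δ/δB)𝓗_n(0)`, the actual derivative of the window's chart at `B = 0` (reading P-R2-6: [I]'s 𝐇_j(□₀,·) is the ℋ
of [15] (174)/(179) for the localised problem).  Uniformity of the constant in `n` comes from UNIFORM letters (one `δ₀, B_G, θ_W, c_Δ, A₀,
A_H, θ_𝔇, c` for all windows and equal cutting costs `κ_B, κ_N, κ₃` of the block sizes — e.g. `1` for sharp blocks).

WHAT THIS FILE PROVES (kernel-checked, zero `sorry`; theorems only — no `def`, no new `Prop`, no named fact; axioms standard).
§1 `ineq190_sectG_zero` — (190) for the actual derivative AT THE BASE POINT `B = 0` of one scheme (r08's `ineq190_sectG` with the domain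
   conditions `‖H₀0‖ < a`, `‖Δ⁽²⁾H₀0‖ < j` discharged by `0 < a`, `0 < j`).
§2 `decay510_window_sectG` — **(5.10) `B12Sec2to5.Decay510 P (4E₀α₂⁻²(Cst·κ_B·c·m)²e^{2dδ₁}K₀(4·2ᵈ,2d)K₁(τθ/2)) δ₁`, `δ₁ = ½min{τθ, κ/d}`,
   `Cst = const190 κ_B κ_N κ₃ B_G θ_W c_Δ A₀ A_H θ_𝔇 c`**, on exhausting windows of ℤᵈ: b03 g4's `decay510_window_190` with `h190`
   DISCHARGED — per window a [15] Sect. G scheme (`𝒳 n, 𝒴 n, 𝒵 n`, data `𝒢, W, Δ⁽²⁾, H₀, H, D`, a `Regime`), its located leaves at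
   `B = 0` with uniform letters, ONE size `bN n` on `𝒴 n` (the (4.4)-functional being dominated by it over the blocks meeting `X`,
   b03's `NormDominated` with the index type `Unit`).
§3 (v1.1) `secondMoment_abs_le_sectG` — **the p. 264 clause «uniformly bounded on this interval» to the extent [I] §5 proves it**:
   for a component kernel `K μ ν` obtained as in §2, the second moment (1.22)/(5.42) `B12Beta.secondMoment K μ ν = Σ_x K_{μν}(x)x_μx_ν`
   converges absolutely and `|Σ_x K_{μν}(x)x_μx_ν| ≤ B12Sec2to5.betaPrime510 d C δ₁ = C·Σ_{x∈ℤᵈ}|x|₁²e^{−δ₁|x|₁}` with the EXPLICIT `C, δ₁`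
   of §2 — §2 composed with b12's `B12Sec2to5.secondMoment_abs_le_of_decay510`; the constant depends on the uniform letters only (not on
   the step), which is the uniformity in `j`; `betaBound_sectG` = the same in the shape `|β| ≤ β′` for any real `β` given by (5.42).
HONEST SCOPE.  Assembly of landed theorems BY NAME: b03 g4 `B12Decay510FromB11` (+ its lineage `B12Decay510`, `B12Decay510Window`), r08
`B11Ineq190Actual` (p304614).  What is LEFT as hypothesis in §2, exactly: (i) per window, r08's located leaves of [15] Sect. G at `B = 0`
— `Regime (𝒢 n) 0 (W n) …`, `W n` analytic on `‖Y‖ < a₃`, the Sect. C map differentiable at `𝒜₀(0) + H₀0` with (73)-majorant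
`θ_𝔇e^{−½δ₀d}` (`hDfr`), (189) there (`h189`, G-B11-G2), the kernel letters `hG`/`hD2H0`/`hH0`/`hH`, (2.54) `htri`/`hdist`, `q < 1` (`hq`),
the compatibility letters `hN`/`hBloc`, with the real letters `δ₀, B_G, θ_W, c_Δ, A₀, A_H, θ_𝔇, c, σ` UNIFORM in `n` and the cutting costs
EQUAL to `κ_B, κ_N, κ₃` (`hκ`); (ii) b03's dictionary letters verbatim — `NormDominated` (the (4.4)-functional of `X` ≤ the local size over
the blocks meeting `X`), the unit source fields `u n x` of B-size `≤ m` (`hm`) localised with conversion factor `θ` (`hD`), ONE row sum (2.61)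
at rate `σ`, `0 < τ`, `σ + τ ≤ ⅛δ₀`; (iii) b03's analytic/representation leaves verbatim — (4.4) analyticity and (1.18) sup of the window
functions `EX n X` on the `α₂`-ball, the mixed-derivative representation `hrepr` of the two-point kernel with the inner linear map THE
ACTUAL DERIVATIVE, the tree-decay threshold `κ₀(4·2ᵈ,2d) ≤ κ/2`, the window limit `hlim`.  NOT HERE: the identification of `P` with the
Π of (5.42) beyond b03's `hlim`/`hrepr` letters; the higher blocks of p. 282; the words *«and finally Proposition 2 and (181)»* of [15]
(G-B11-G2a) — at `B = 0` no transport is needed.  NOT summit progress.  r20 gen 13 (literature-prover-lit-balaban-r20-g13-0).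
v1.1 (§3, r20 gen 14, literature-prover-lit-balaban-r20-g14-0): what §5 yields toward Theorem 2 is a two-sided ABSOLUTE bound on β —
NOT the smoothness / derivative bounds of the p. 264 sentence (*«smooth … (or analytic), uniformly bounded on this interval together with
all derivatives. We will investigate other properties in a separate paper.»* — no such paper; `B12BetaSmooth.BetaDerivBoundsAt`
names that unprinted layer) and NOT a positive lower bound (`B12Sec2to5.betaLower_neg_of_decay510`); §3 adds one hypothesis `0 < κ`.
-/

noncomputable section

open Set Metric Filter Topology

namespace Literature.MathematicalPhysics.QuantumFieldTheory.Balaban1983to89.B12Decay510SectG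

open Literature.MathematicalPhysics.QuantumFieldTheory.Balaban1983to89
open B11SectG B11Eq174Chart B11Eq183Differentiation B11Ineq190Actual B12Decay510 B12Decay510FromB11 B6RandomWalk
open Literature.MathematicalPhysics.QuantumFieldTheory.Balaban1983to89.B13ScaleTransfer (Pt)
open Literature.MathematicalPhysics.QuantumFieldTheory.Balaban1983to89.TreeLength (treeLen)
open Literature.MathematicalPhysics.QuantumFieldTheory.Balaban1983to89.TreeLengthCubeSystem (Dom sys)
open Literature.MathematicalPhysics.QuantumFieldTheory.Balaban1983to89.B12TreeDecay (K₀ kappa₀)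
open Literature.MathematicalPhysics.QuantumFieldTheory.Balaban1983to89.B12Decay510Window (geom)

/-- The (190) constant `const190 …` of `B11SectG` is `≥ 0` for non-negative data under `q < 1` (private copy of p29's
`B16Ineq123From190.const190_nonneg`, import cone kept inside B11/B12). [cite: Balaban1985Variational, (187)–(190) p.308] -/
private theorem const190_nonneg' {κB κN κ₃ BG θW cΔ A₀ AH θD c : ℝ} (hκB : 0 ≤ κB) (hκN : 0 ≤ κN) (hκ₃ : 0 ≤ κ₃)
    (hc : 0 ≤ c) (hBG : 0 ≤ BG) (hθW : 0 ≤ θW) (hcΔ : 0 ≤ cΔ) (hA₀ : 0 ≤ A₀) (hAH : 0 ≤ AH) (hθD : 0 ≤ θD)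
    (hq : qG κ₃ κN BG θW c < 1) : 0 ≤ const190 κB κN κ₃ BG θW cΔ A₀ AH θD c := by
  unfold const190
  have h₁ := constA0_nonneg (cΔ := cΔ) hκ₃ hκN hBG hθW hcΔ hA₀ hc hq
  positivity

/-! ## §1 (190) for the actual derivative at the base point `B = 0` -/

section Zero

variable {𝒳 𝒴 𝒵 : Type} [NormedAddCommGroup 𝒳] [NormedSpace ℂ 𝒳] [NormedAddCommGroup 𝒴] [NormedSpace ℂ 𝒴]
  [NormedAddCommGroup 𝒵] [NormedSpace ℂ 𝒵] [CompleteSpace 𝒳] [CompleteSpace 𝒴] [CompleteSpace 𝒵]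
  {𝒢 : 𝒵 →L[ℂ] 𝒴} {W : 𝒴 → 𝒵} {D2 : 𝒴 →L[ℂ] 𝒵} {H₀ : 𝒳 →L[ℂ] 𝒴} {B₀ θ C₄ a₃ j a ε₄ : ℝ}
  {g : B6.Geometry}

/-- **(190) FOR THE ACTUAL DERIVATIVE `(δ/δB)𝓗(0)` AT THE BASE POINT** ([I] p. 282 / (4.3): the derivatives of `𝐇_j(□₀,·)` at
`B = 0`): r08's `B11Ineq190Actual.ineq190_sectG` at `B = 0`, where the domain conditions of (180) reduce to `0 < a`, `0 < j`
(`H₀0 = 0`).  At the base point the words *«and finally Proposition 2 and (181)»* (transport, G-B11-G2a) are not needed.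
[cite: Balaban1985Variational, Prop. 9 (190) pp.308–309, (179)–(180) p.306] [cite: Balaban1987RG1, p.282] -/
theorem ineq190_sectG_zero (R : Regime 𝒢 0 W B₀ θ C₄ a₃ j a ε₄) (hWa : AnalyticOnNhd ℂ W {Y : 𝒴 | ‖Y‖ < a₃})
    (hj : 0 < j) (ha : 0 < a) {Dm : 𝒴 → 𝒳} {𝔇 : 𝒴 →L[ℂ] 𝒳} (H : 𝒳 →L[ℂ] 𝒴)
    (hD : HasFDerivAt Dm 𝔇 (solA180 𝒢 W D2 H₀ ε₄ 0 + H₀ 0))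
    {bB : BlockNorm g 𝒳} {bN : BlockNorm g 𝒴} {b3 : BlockNorm g 𝒵}
    (hN : ∀ (y : g.Site) (v : 𝒴), bN.loc y v ≤ ‖v‖) (hBloc : ∀ (y' : g.Site) (μ : 𝒳), bB.IsLoc y' μ → ‖μ‖ ≤ bB.loc y' μ)
    {δ₀ BG θW cΔ A₀ AH θD c : ℝ}
    (htri : Triangle254 g) (hd : ∀ a b : g.Site, 0 ≤ g.dist a b) (hδ₀ : 0 ≤ δ₀) (hrow : RowSum g (δ₀ / 8) c)
    (hc : 0 ≤ c) (hBG : 0 ≤ BG) (hθW : 0 ≤ θW) (hcΔ : 0 ≤ cΔ) (hA₀ : 0 ≤ A₀) (hAH : 0 ≤ AH) (hθD : 0 ≤ θD)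
    (hG : HasMaj b3 bN (𝒢.restrictScalars ℝ : 𝒵 →ₗ[ℝ] 𝒴) (fun y y' => BG * Real.exp (-(δ₀ * g.dist y y'))))
    (h189 : Ineq189 bN b3 ((fderiv ℂ W (solA180 𝒢 W D2 H₀ ε₄ 0 + H₀ 0)).restrictScalars ℝ : 𝒴 →ₗ[ℝ] 𝒵) θW δ₀)
    (hD2H0 : HasMaj bB b3 ((D2 ∘L H₀).restrictScalars ℝ : 𝒳 →ₗ[ℝ] 𝒵) (fun y y' => cΔ * Real.exp (-(δ₀ * g.dist y y'))))
    (hH0 : HasMaj bB bN (H₀.restrictScalars ℝ : 𝒳 →ₗ[ℝ] 𝒴) (fun y y' => A₀ * Real.exp (-(δ₀ * g.dist y y'))))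
    (hH : HasMaj bB bN (H.restrictScalars ℝ : 𝒳 →ₗ[ℝ] 𝒴) (fun y y' => AH * Real.exp (-(δ₀ / 2 * g.dist y y'))))
    (hDfr : HasMaj bN bB (𝔇.restrictScalars ℝ : 𝒴 →ₗ[ℝ] 𝒳) (fun y y' => θD * Real.exp (-(δ₀ / 2 * g.dist y y'))))
    (hq : qG b3.κ bN.κ BG θW c < 1) :
    Ineq190 bB bN
      ((fderiv ℂ (chartH179 𝒢 W D2 H₀ (fun Y : 𝒴 => Y - H (Dm Y)) ε₄) 0).restrictScalars ℝ : 𝒳 →ₗ[ℝ] 𝒴)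
      (const190 bB.κ bN.κ b3.κ BG θW cΔ A₀ AH θD c) δ₀ := by
  have hJ : ‖D2 (H₀ (0 : 𝒳))‖ < j := by simpa using hj
  have h𝔄 : ‖H₀ (0 : 𝒳)‖ < a := by simpa using ha
  exact ineq190_sectG R hWa hJ h𝔄 H hD hN hBloc htri hd hδ₀ hrow hc hBG hθW hcΔ hA₀ hAH hθD hG h189 hD2H0 hH0 hH hDfr hq

end Zero

/-! ## §2 (5.10) on exhausting windows with the (190) record supplied from [15] Sect. G -/

section Window

variable {I : Type*}

/-- **(5.10) `B12Sec2to5.Decay510` ON EXHAUSTING WINDOWS OF ℤᵈ, THE (190) RECORD SUPPLIED BY NAME FROM [15] SECT. G** — b03 g4's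
`B12Decay510FromB11.decay510_window_190` with, on the n-th window, `dH n :=` the ACTUAL Fréchet derivative at `B = 0` of the window's
[15] (179) chart `chartH179 (𝒢 n) (Wf n) (D2 n) (H₀ n) (· − H n (Dm n ·)) (ε₄ n)` (restricted to real scalars) and `h190 n` := §1
(`ineq190_sectG_zero`; r08's `ineq190_sectG` by name), the index of sizes `I := Unit` (ONE size `bN n` on `𝒴 n` dominating the
(4.4)-functional over the blocks meeting `X`).  The constant of (5.10) is b03's with `C := const190 κ_B κ_N κ₃ B_G θ_W c_Δ A₀ A_H θ_𝔇 c`,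
uniform in `n` because the letters are (`hκ`: equal cutting costs).  Every other hypothesis is b03's or r08's, verbatim.
[cite: Balaban1987RG1, (5.10) p.293, p.282] [cite: Balaban1985Variational, Prop. 9 (190) pp.308–309]
[cite: Balaban1984PropagatorsII, Lemma 2.1 (2.61) p.234] -/
theorem decay510_window_sectG {d : ℕ} (hd : 0 < d) (B : ℕ → Finset (Pt d)) (Wn : ℕ → Type*)
    [∀ n, NormedAddCommGroup (Wn n)] [∀ n, NormedSpace ℂ (Wn n)]
    (EXn : (n : ℕ) → Dom (B n) → Wn n → ℂ) (E2n : (n : ℕ) → Dom (B n) → Pt d → Pt d → ℝ) (P : Pt d → ℝ)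
    (gn : ℕ → B6.Geometry)
    -- the [15] Sect. G schemes, one per window
    (𝒳n 𝒴n 𝒵n : ℕ → Type) [∀ n, NormedAddCommGroup (𝒳n n)] [∀ n, NormedSpace ℂ (𝒳n n)] [∀ n, CompleteSpace (𝒳n n)]
    [∀ n, NormedAddCommGroup (𝒴n n)] [∀ n, NormedSpace ℂ (𝒴n n)] [∀ n, CompleteSpace (𝒴n n)]
    [∀ n, NormedAddCommGroup (𝒵n n)] [∀ n, NormedSpace ℂ (𝒵n n)] [∀ n, CompleteSpace (𝒵n n)]
    (𝒢n : (n : ℕ) → 𝒵n n →L[ℂ] 𝒴n n) (Wfn : (n : ℕ) → 𝒴n n → 𝒵n n) (D2n : (n : ℕ) → 𝒴n n →L[ℂ] 𝒵n n)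
    (H₀n : (n : ℕ) → 𝒳n n →L[ℂ] 𝒴n n) (Hn : (n : ℕ) → 𝒳n n →L[ℂ] 𝒴n n) (Dmn : (n : ℕ) → 𝒴n n → 𝒳n n)
    (B₀n θn C₄n a₃n jn an ε₄n : ℕ → ℝ)
    (Rn : ∀ n, Regime (𝒢n n) 0 (Wfn n) (B₀n n) (θn n) (C₄n n) (a₃n n) (jn n) (an n) (ε₄n n))
    (hWan : ∀ n, AnalyticOnNhd ℂ (Wfn n) {Y : 𝒴n n | ‖Y‖ < a₃n n})
    (hjn : ∀ n, 0 < jn n) (han : ∀ n, 0 < an n)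
    (bBn : (n : ℕ) → BlockNorm (gn n) (𝒳n n)) (bNn : (n : ℕ) → BlockNorm (gn n) (𝒴n n))
    (b3n : (n : ℕ) → BlockNorm (gn n) (𝒵n n))
    (hN : ∀ n (y : (gn n).Site) (v : 𝒴n n), (bNn n).loc y v ≤ ‖v‖)
    (hBloc : ∀ n (y' : (gn n).Site) (μ : 𝒳n n), (bBn n).IsLoc y' μ → ‖μ‖ ≤ (bBn n).loc y' μ)
    {δ₀ BG θW cΔ A₀ AH θD c σ τ m θ κB κN κ3 α₂ E₀ κ : ℝ}
    (htri : ∀ n, Triangle254 (gn n)) (hdist : ∀ n (a b : (gn n).Site), 0 ≤ (gn n).dist a b) (hδ₀ : 0 ≤ δ₀)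
    (hrow : ∀ n, RowSum (gn n) σ c) (hc : 0 ≤ c) (hτ : 0 < τ) (hθ : 0 < θ) (hστ : σ + τ ≤ δ₀ / 8)
    (hBG : 0 ≤ BG) (hθW : 0 ≤ θW) (hcΔ : 0 ≤ cΔ) (hA₀ : 0 ≤ A₀) (hAH : 0 ≤ AH) (hθD : 0 ≤ θD)
    (hκ : ∀ n, (bBn n).κ = κB ∧ (bNn n).κ = κN ∧ (b3n n).κ = κ3)
    (hG : ∀ n, HasMaj (b3n n) (bNn n) ((𝒢n n).restrictScalars ℝ : 𝒵n n →ₗ[ℝ] 𝒴n n)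
      (fun y y' => BG * Real.exp (-(δ₀ * (gn n).dist y y'))))
    (h189 : ∀ n, Ineq189 (bNn n) (b3n n)
      ((fderiv ℂ (Wfn n) (solA180 (𝒢n n) (Wfn n) (D2n n) (H₀n n) (ε₄n n) 0 + H₀n n 0)).restrictScalars ℝ :
        𝒴n n →ₗ[ℝ] 𝒵n n) θW δ₀)
    (hD2H0 : ∀ n, HasMaj (bBn n) (b3n n) (((D2n n) ∘L (H₀n n)).restrictScalars ℝ : 𝒳n n →ₗ[ℝ] 𝒵n n)
      (fun y y' => cΔ * Real.exp (-(δ₀ * (gn n).dist y y'))))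
    (hH0 : ∀ n, HasMaj (bBn n) (bNn n) ((H₀n n).restrictScalars ℝ : 𝒳n n →ₗ[ℝ] 𝒴n n)
      (fun y y' => A₀ * Real.exp (-(δ₀ * (gn n).dist y y'))))
    (hH : ∀ n, HasMaj (bBn n) (bNn n) ((Hn n).restrictScalars ℝ : 𝒳n n →ₗ[ℝ] 𝒴n n)
      (fun y y' => AH * Real.exp (-(δ₀ / 2 * (gn n).dist y y'))))
    (hDfr : ∀ n, ∃ 𝔇 : 𝒴n n →L[ℂ] 𝒳n n,
      HasFDerivAt (Dmn n) 𝔇 (solA180 (𝒢n n) (Wfn n) (D2n n) (H₀n n) (ε₄n n) 0 + H₀n n 0) ∧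
        HasMaj (bNn n) (bBn n) (𝔇.restrictScalars ℝ : 𝒴n n →ₗ[ℝ] 𝒳n n)
          (fun y y' => θD * Real.exp (-(δ₀ / 2 * (gn n).dist y y'))))
    (hq : qG κ3 κN BG θW c < 1)
    -- b03's dictionary letters, with the single size `bN n`
    (blkn : (n : ℕ) → Dom (B n) → Finset (gn n).Site) (ιn : (n : ℕ) → Dom (B n) → 𝒴n n → Wn n)
    (un : (n : ℕ) → Pt d → 𝒳n n)
    (hNdom : ∀ n, NormDominated (S := sys (B n)) (fun _ : Unit => bNn n) (blkn n) (V := fun _ => Wn n) (ιn n))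
    (hm₀ : 0 ≤ m) (hm : ∀ n x y', (bBn n).loc y' (un n x) ≤ m)
    (hD : ∀ n, UnitFieldsLocalised (bBn n) (geom (B n)) (blkn n) (un n) θ)
    -- b03's analytic / representation / limit leaves
    (hα₂ : 0 < α₂) (hE₀ : 0 ≤ E₀) (hκ₀ : kappa₀ (4 * 2 ^ d) (2 * d) ≤ κ / 2)
    (hanE : ∀ n X, AnalyticOnNhd ℂ (EXn n X) (ball 0 α₂))
    (h118 : ∀ n X, ∀ v ∈ ball (0 : Wn n) α₂, ‖EXn n X v‖ ≤ E₀ * Real.exp (-κ * treeLen X.1))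
    (hrepr : ∀ n X x y, E2n n X x y =
      (mixedDeriv (EXn n X)
        (ιn n X (fderiv ℂ (chartH179 (𝒢n n) (Wfn n) (D2n n) (H₀n n) (fun Y : 𝒴n n => Y - Hn n (Dmn n Y)) (ε₄n n)) 0
          (un n x)))
        (ιn n X (fderiv ℂ (chartH179 (𝒢n n) (Wfn n) (D2n n) (H₀n n) (fun Y : 𝒴n n => Y - Hn n (Dmn n Y)) (ε₄n n)) 0
          (un n y)))).re)
    (hlim : ∀ z, Tendsto (fun n => ∑ X : Dom (B n), E2n n X 0 z) atTop (𝓝 (P z))) :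
    B12Sec2to5.Decay510 P
      (4 * E₀ / α₂ ^ 2 * (const190 κB κN κ3 BG θW cΔ A₀ AH θD c * κB * c * m) ^ 2 *
        Real.exp (delta1 (τ * θ) κ d * d * 2) * K₀ (4 * 2 ^ d) (2 * d) * B12Decay510Window.K₁ d (τ * θ / 2))
      (delta1 (τ * θ) κ d) := by
  -- the (190) record on every window, for the actual derivative at `B = 0`, with the uniform constant
  have hκB0 : 0 ≤ κB := by rw [← (hκ 0).1]; exact (bBn 0).κ_nonneg
  have hκN0 : 0 ≤ κN := by rw [← (hκ 0).2.1]; exact (bNn 0).κ_nonneg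
  have hκ30 : 0 ≤ κ3 := by rw [← (hκ 0).2.2]; exact (b3n 0).κ_nonneg
  have hCst : 0 ≤ const190 κB κN κ3 BG θW cΔ A₀ AH θD c :=
    const190_nonneg' hκB0 hκN0 hκ30 hc hBG hθW hcΔ hA₀ hAH hθD hq
  have hσ8 : σ ≤ δ₀ / 8 := by linarith
  have h190 : ∀ n (_ : Unit), Ineq190 (bBn n) (bNn n)
      ((fderiv ℂ (chartH179 (𝒢n n) (Wfn n) (D2n n) (H₀n n) (fun Y : 𝒴n n => Y - Hn n (Dmn n Y)) (ε₄n n)) 0).restrictScalars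
        ℝ : 𝒳n n →ₗ[ℝ] 𝒴n n)
      (const190 κB κN κ3 BG θW cΔ A₀ AH θD c) δ₀ := by
    intro n _
    obtain ⟨𝔇, hD𝔇, h𝔇⟩ := hDfr n
    obtain ⟨h1, h2, h3⟩ := hκ n
    have hq' : qG (b3n n).κ (bNn n).κ BG θW c < 1 := by rw [h2, h3]; exact hq
    have h := ineq190_sectG_zero (Rn n) (hWan n) (hjn n) (han n) (Hn n) hD𝔇 (hN n) (hBloc n) (htri n) (hdist n) hδ₀
      ((hrow n).mono (hdist n) hσ8) hc hBG hθW hcΔ hA₀ hAH hθD (hG n) (h189 n) (hD2H0 n) (hH0 n) (hH n) h𝔇 hq'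
    rw [h1, h2, h3] at h
    exact h
  exact decay510_window_190 hd B Wn EXn E2n P gn 𝒳n 𝒴n bBn (fun n (_ : Unit) => bNn n)
    (fun n => ((fderiv ℂ (chartH179 (𝒢n n) (Wfn n) (D2n n) (H₀n n) (fun Y : 𝒴n n => Y - Hn n (Dmn n Y)) (ε₄n n))
      0).restrictScalars ℝ : 𝒳n n →ₗ[ℝ] 𝒴n n))
    blkn ιn un h190 hCst hdist hrow hc hτ hθ hστ (fun n => (hκ n).1.le) hNdom hm₀ hm hD hα₂ hE₀ hκ₀ hanE h118
    (fun n X x y => by simpa using hrepr n X x y) hlim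

end Window

/-! ## §3 (v1.1) The second moment (1.22)/(5.42) of a kernel obtained as in §2 — «uniformly bounded», p. 264 -/

section Beta

/-- **[I] p. 264, the clause «It is a smooth function defined on the interval [0, γ], (or analytic), uniformly bounded on this interval
together with all derivatives» — THE VALUE BOUND, which is the part [I] §5 proves ((5.42) + (5.10)), FROM PRINTED INPUTS WITH (190) [15]
DISCHARGED.**  If the (μ, ν)-component `K μ ν` of a kernel `K : B12Beta.Kernel d` is the window limit of §2 (same hypotheses, with `P :=
K μ ν`, plus `0 < κ`), then the lattice sum (1.22) `β = Σ_{x∈ℤᵈ} K_{μν}(x) x_μ x_ν = B12Beta.secondMoment K μ ν` converges absolutely and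
`|Σ_x K_{μν}(x) x_μ x_ν| ≤ B12Sec2to5.betaPrime510 d C δ₁` (= `C · Σ_x |x|₁² e^{−δ₁|x|₁}`) with the explicit `C, δ₁` of §2 — a constant
depending only on the uniform letters (hence on E₀, α₂, δ₀-data, κ, d), not on the step: §2 ∘ `B12Sec2to5.secondMoment_abs_le_of_decay510`.
What is NOT obtained: smoothness / derivative bounds in g (unprinted, `B12BetaSmooth.BetaDerivBoundsAt`), a sign of β (unprinted;
`B12Sec2to5.betaLower_neg_of_decay510` is all §5 gives).  [cite: Balaban1987RG1, (1.22) p.264, (5.42) p.297, (5.10) p.293]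
[cite: Balaban1985Variational, Prop. 9 (190) pp.308–309] -/
theorem secondMoment_abs_le_sectG {d : ℕ} (hd : 0 < d) (B : ℕ → Finset (Pt d)) (Wn : ℕ → Type*)
    [∀ n, NormedAddCommGroup (Wn n)] [∀ n, NormedSpace ℂ (Wn n)]
    (EXn : (n : ℕ) → Dom (B n) → Wn n → ℂ) (E2n : (n : ℕ) → Dom (B n) → Pt d → Pt d → ℝ)
    (K : B12Beta.Kernel d) (μ ν : Fin d)
    (gn : ℕ → B6.Geometry)
    -- the [15] Sect. G schemes, one per window
    (𝒳n 𝒴n 𝒵n : ℕ → Type) [∀ n, NormedAddCommGroup (𝒳n n)] [∀ n, NormedSpace ℂ (𝒳n n)] [∀ n, CompleteSpace (𝒳n n)]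
    [∀ n, NormedAddCommGroup (𝒴n n)] [∀ n, NormedSpace ℂ (𝒴n n)] [∀ n, CompleteSpace (𝒴n n)]
    [∀ n, NormedAddCommGroup (𝒵n n)] [∀ n, NormedSpace ℂ (𝒵n n)] [∀ n, CompleteSpace (𝒵n n)]
    (𝒢n : (n : ℕ) → 𝒵n n →L[ℂ] 𝒴n n) (Wfn : (n : ℕ) → 𝒴n n → 𝒵n n) (D2n : (n : ℕ) → 𝒴n n →L[ℂ] 𝒵n n)
    (H₀n : (n : ℕ) → 𝒳n n →L[ℂ] 𝒴n n) (Hn : (n : ℕ) → 𝒳n n →L[ℂ] 𝒴n n) (Dmn : (n : ℕ) → 𝒴n n → 𝒳n n)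
    (B₀n θn C₄n a₃n jn an ε₄n : ℕ → ℝ)
    (Rn : ∀ n, Regime (𝒢n n) 0 (Wfn n) (B₀n n) (θn n) (C₄n n) (a₃n n) (jn n) (an n) (ε₄n n))
    (hWan : ∀ n, AnalyticOnNhd ℂ (Wfn n) {Y : 𝒴n n | ‖Y‖ < a₃n n})
    (hjn : ∀ n, 0 < jn n) (han : ∀ n, 0 < an n)
    (bBn : (n : ℕ) → BlockNorm (gn n) (𝒳n n)) (bNn : (n : ℕ) → BlockNorm (gn n) (𝒴n n))
    (b3n : (n : ℕ) → BlockNorm (gn n) (𝒵n n))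
    (hN : ∀ n (y : (gn n).Site) (v : 𝒴n n), (bNn n).loc y v ≤ ‖v‖)
    (hBloc : ∀ n (y' : (gn n).Site) (μ' : 𝒳n n), (bBn n).IsLoc y' μ' → ‖μ'‖ ≤ (bBn n).loc y' μ')
    {δ₀ BG θW cΔ A₀ AH θD c σ τ m θ κB κN κ3 α₂ E₀ κ : ℝ}
    (htri : ∀ n, Triangle254 (gn n)) (hdist : ∀ n (a b : (gn n).Site), 0 ≤ (gn n).dist a b) (hδ₀ : 0 ≤ δ₀)
    (hrow : ∀ n, RowSum (gn n) σ c) (hc : 0 ≤ c) (hτ : 0 < τ) (hθ : 0 < θ) (hστ : σ + τ ≤ δ₀ / 8)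
    (hBG : 0 ≤ BG) (hθW : 0 ≤ θW) (hcΔ : 0 ≤ cΔ) (hA₀ : 0 ≤ A₀) (hAH : 0 ≤ AH) (hθD : 0 ≤ θD)
    (hκ : ∀ n, (bBn n).κ = κB ∧ (bNn n).κ = κN ∧ (b3n n).κ = κ3)
    (hG : ∀ n, HasMaj (b3n n) (bNn n) ((𝒢n n).restrictScalars ℝ : 𝒵n n →ₗ[ℝ] 𝒴n n)
      (fun y y' => BG * Real.exp (-(δ₀ * (gn n).dist y y'))))
    (h189 : ∀ n, Ineq189 (bNn n) (b3n n)
      ((fderiv ℂ (Wfn n) (solA180 (𝒢n n) (Wfn n) (D2n n) (H₀n n) (ε₄n n) 0 + H₀n n 0)).restrictScalars ℝ :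
        𝒴n n →ₗ[ℝ] 𝒵n n) θW δ₀)
    (hD2H0 : ∀ n, HasMaj (bBn n) (b3n n) (((D2n n) ∘L (H₀n n)).restrictScalars ℝ : 𝒳n n →ₗ[ℝ] 𝒵n n)
      (fun y y' => cΔ * Real.exp (-(δ₀ * (gn n).dist y y'))))
    (hH0 : ∀ n, HasMaj (bBn n) (bNn n) ((H₀n n).restrictScalars ℝ : 𝒳n n →ₗ[ℝ] 𝒴n n)
      (fun y y' => A₀ * Real.exp (-(δ₀ * (gn n).dist y y'))))
    (hH : ∀ n, HasMaj (bBn n) (bNn n) ((Hn n).restrictScalars ℝ : 𝒳n n →ₗ[ℝ] 𝒴n n)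
      (fun y y' => AH * Real.exp (-(δ₀ / 2 * (gn n).dist y y'))))
    (hDfr : ∀ n, ∃ 𝔇 : 𝒴n n →L[ℂ] 𝒳n n,
      HasFDerivAt (Dmn n) 𝔇 (solA180 (𝒢n n) (Wfn n) (D2n n) (H₀n n) (ε₄n n) 0 + H₀n n 0) ∧
        HasMaj (bNn n) (bBn n) (𝔇.restrictScalars ℝ : 𝒴n n →ₗ[ℝ] 𝒳n n)
          (fun y y' => θD * Real.exp (-(δ₀ / 2 * (gn n).dist y y'))))
    (hq : qG κ3 κN BG θW c < 1)
    -- b03's dictionary letters, with the single size `bN n`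
    (blkn : (n : ℕ) → Dom (B n) → Finset (gn n).Site) (ιn : (n : ℕ) → Dom (B n) → 𝒴n n → Wn n)
    (un : (n : ℕ) → Pt d → 𝒳n n)
    (hNdom : ∀ n, NormDominated (S := sys (B n)) (fun _ : Unit => bNn n) (blkn n) (V := fun _ => Wn n) (ιn n))
    (hm₀ : 0 ≤ m) (hm : ∀ n x y', (bBn n).loc y' (un n x) ≤ m)
    (hD : ∀ n, UnitFieldsLocalised (bBn n) (geom (B n)) (blkn n) (un n) θ)
    -- b03's analytic / representation / limit leaves
    (hα₂ : 0 < α₂) (hE₀ : 0 ≤ E₀) (hκpos : 0 < κ) (hκ₀ : kappa₀ (4 * 2 ^ d) (2 * d) ≤ κ / 2)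
    (hanE : ∀ n X, AnalyticOnNhd ℂ (EXn n X) (ball 0 α₂))
    (h118 : ∀ n X, ∀ v ∈ ball (0 : Wn n) α₂, ‖EXn n X v‖ ≤ E₀ * Real.exp (-κ * treeLen X.1))
    (hrepr : ∀ n X x y, E2n n X x y =
      (mixedDeriv (EXn n X)
        (ιn n X (fderiv ℂ (chartH179 (𝒢n n) (Wfn n) (D2n n) (H₀n n) (fun Y : 𝒴n n => Y - Hn n (Dmn n Y)) (ε₄n n)) 0
          (un n x)))
        (ιn n X (fderiv ℂ (chartH179 (𝒢n n) (Wfn n) (D2n n) (H₀n n) (fun Y : 𝒴n n => Y - Hn n (Dmn n Y)) (ε₄n n)) 0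
          (un n y)))).re)
    (hlim : ∀ z, Tendsto (fun n => ∑ X : Dom (B n), E2n n X 0 z) atTop (𝓝 (K μ ν z))) :
    Summable (fun x : Fin d → ℤ => K μ ν x * (x μ : ℝ) * (x ν : ℝ)) ∧
      |B12Beta.secondMoment K μ ν| ≤
        B12Sec2to5.betaPrime510 d
          (4 * E₀ / α₂ ^ 2 * (const190 κB κN κ3 BG θW cΔ A₀ AH θD c * κB * c * m) ^ 2 *
            Real.exp (delta1 (τ * θ) κ d * d * 2) * K₀ (4 * 2 ^ d) (2 * d) * B12Decay510Window.K₁ d (τ * θ / 2))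
          (delta1 (τ * θ) κ d) := by
  have hdec := decay510_window_sectG hd B Wn EXn E2n (K μ ν) gn 𝒳n 𝒴n 𝒵n 𝒢n Wfn D2n H₀n Hn Dmn B₀n θn C₄n a₃n jn an
    ε₄n Rn hWan hjn han bBn bNn b3n hN hBloc htri hdist hδ₀ hrow hc hτ hθ hστ hBG hθW hcΔ hA₀ hAH hθD hκ hG h189 hD2H0
    hH0 hH hDfr hq blkn ιn un hNdom hm₀ hm hD hα₂ hE₀ hκ₀ hanE h118 hrepr hlim
  have hδ₁ : 0 < delta1 (τ * θ) κ d := delta1_pos (mul_pos hτ hθ) hκpos (by exact_mod_cast hd)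
  have h := B12Sec2to5.secondMoment_abs_le_of_decay510 (P := K) (μ := μ) (ν := ν) hδ₁ hdec
  refine ⟨h.1, ?_⟩
  unfold B12Sec2to5.betaPrime510
  exact h.2

/-- **The same bound in the shape of the β-clause** (`Step.SFHyp.betaBound` / [I] p. 264 «uniformly bounded on this interval»): if a
real number `β` is GIVEN BY (5.42) — `β = Σ_x K_{μν}(x) x_μ x_ν` for a kernel component obtained as in §2 — then `|β| ≤ β′` with
`β′ = B12Sec2to5.betaPrime510 d C δ₁`, a constant of the uniform letters only.  Pure restatement of §3's first theorem for consumers that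
carry β as a number (e.g. one step `β_{j+1}(g_j)` of a flow); nothing about the dependence on `g_j` is asserted.
[cite: Balaban1987RG1, (1.22) p.264, (5.42) p.297] -/
theorem betaBound_sectG {d : ℕ} {K : B12Beta.Kernel d} {μ ν : Fin d} {β C δ₁ : ℝ}
    (hβ : β = B12Beta.secondMoment K μ ν)
    (hK : Summable (fun x : Fin d → ℤ => K μ ν x * (x μ : ℝ) * (x ν : ℝ)) ∧
      |B12Beta.secondMoment K μ ν| ≤ B12Sec2to5.betaPrime510 d C δ₁) :
    |β| ≤ B12Sec2to5.betaPrime510 d C δ₁ ∧ -B12Sec2to5.betaPrime510 d C δ₁ ≤ β ∧ β ≤ B12Sec2to5.betaPrime510 d C δ₁ := by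
  subst hβ
  exact ⟨hK.2, neg_le_of_abs_le hK.2, le_trans (le_abs_self _) hK.2⟩

end Beta

end Literature.MathematicalPhysics.QuantumFieldTheory.Balaban1983to89.B12Decay510SectG

end
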